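import Summits.QuantumAdvantage.Statement
import Literature.StrongHypotheses.QuantumAdvantage
import Literature.Computability.Complexity.SipserGacsLautemann
import Literature.Computability.Complexity.PolyHierarchy
import Literature.Computability.Cryptography.ShorAssemblyLeavesProofs
import Summits.QuantumAdvantage.QuantumAdvantage.Theorems.FactoringAssumption
import HarnessLib
import HarnessLib.Audit.TribunalTags

/-!
# Summit `QuantumAdvantage` — bridges of the Strong-Hypothesis Library (D-0034, skeleton)

Summit-side BRIDGE file for the registry `Literature/StrongHypotheses/QuantumAdvantage.lean`: for every
`H` tagged with `@[strong_hypothesis "QuantumAdvantage.QuantumAdvantage"]` (there, or — for summit-side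
conjecture `def`s — here), exactly ONE bridge tagged `@[summit_bridge "QuantumAdvantage.QuantumAdvantage"]`,
concluding the ROOT problem decl `_root_.QuantumAdvantage`
(`Summits/QuantumAdvantage/QuantumAdvantage/Statement.lean`;
`:= Literature.QuantumAdvantage.BQPNotSubsetBPP := ∃ L : Language Bool, L ∈ BQP ∧ L ∉ BPP`).

* Summit-side hypothesis TAGGED here (Literature cannot import it):
  `Summit.QuantumAdvantage.QuantumAdvantage.Theorems.FactoringAssumption` (Goldreich's average-case
  factoring assumption, `@[conjecture]`, `Theorems/FactoringAssumption.lean`).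
* LANDED bridges (2):
  - `factNotMemBPP_implies_quantumAdvantage` — witness `FACT`, by Shor's theorem, discharged in the tree
    as `Literature.Computability.Cryptography.FACT_mem_BQP_holds` (`ShorAssemblyLeavesProofs.lean`);
  - `bqpNotSubsetPH_implies_quantumAdvantage` — Sipser–Gács–Lautemann `BPP ⊆ Σ₂ᵖ`
    (`BPP_subset_SigmaP_two`, `SipserGacsLautemann.lean`) and `Σ₂ᵖ ⊆ PH` (`SigmaP_subset_PH`).
* PRINTED bridge (1), a NAMED FACT (CONVENTIONS §4) to be discharged by a literature-prover as
  `theorem FactoringAssumptionImpliesQuantumAdvantage_holds` in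
  `Summits/QuantumAdvantage/QuantumAdvantage/Theorems/StrongHypothesesFactoringAssumptionBridge.lean`:
  `FactoringAssumptionImpliesQuantumAdvantage` (average-case hardness ⇒ `FACT ∉ BPP` ⇒ summit).

No new mathematics is proved here; no `sorry`, no axiom.
-/

noncomputable section

/-! ## Summit-side conjecture `def`, tagged in place (no restatement) -/

attribute [strong_hypothesis "QuantumAdvantage.QuantumAdvantage"]
  Summit.QuantumAdvantage.QuantumAdvantage.Theorems.FactoringAssumption

namespace Summit.QuantumAdvantage.StrongHypotheses

open Literature.Computability.Complexity
open Literature.Computability.Cryptography (BQP FACT_mem_BQP_holds)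
open Literature.Computability.QuantumComplexity (FACT)
open Literature.StrongHypotheses.QuantumAdvantage
open Summit.QuantumAdvantage.QuantumAdvantage.Theorems (FactoringAssumption)

/-! ## Strictly stronger hypotheses — landed bridges -/

/-- **`FACT ∉ BPP` ⟹ `BQP ⊄ BPP`** (landed): `FACT` is the witness, `FACT ∈ BQP` being Shor's theorem
(discharged in the tree, `FACT_mem_BQP_holds`). [cite: Shor1997SICOMP, §5] -/
@[summit_bridge "QuantumAdvantage.QuantumAdvantage"]
theorem factNotMemBPP_implies_quantumAdvantage : FACTNotMemBPP → _root_.QuantumAdvantage :=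
  fun h => ⟨FACT, FACT_mem_BQP_holds, h⟩

/-- **`BQP ⊄ PH` ⟹ `BQP ⊄ BPP`** (landed): if every `BQP` language were in `BPP`, it would be in
`Σ₂ᵖ ⊆ PH` by Sipser–Gács–Lautemann (`BPP_subset_SigmaP_two`, `SigmaP_subset_PH`).
[cite: Sipser1983, §V (BPP ⊆ Σ₂ᵖ ∩ Π₂ᵖ)] -/
@[summit_bridge "QuantumAdvantage.QuantumAdvantage"]
theorem bqpNotSubsetPH_implies_quantumAdvantage : BQPNotSubsetPH → _root_.QuantumAdvantage := by
  intro h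
  by_contra hS
  refine h fun L hL => ?_
  have hBPP : L ∈ BPP := by
    by_contra hnot
    exact hS ⟨L, hL, hnot⟩
  exact SigmaP_subset_PH 2 (BPP_subset_SigmaP_two hBPP)

/-! ## Strictly stronger hypothesis — printed bridge (named fact) -/

/-- **The factoring assumption ⟹ `BQP ⊄ BPP`** — named fact: Goldreich's average-case factoring
assumption (`FactoringAssumption`: every PPT `A`, given `(1ᵐ, P·Q)` for independent uniform `m`-bit
primes, outputs the smaller prime factor with probability negligible in `m`; Goldreich 2001 §2.2.4.1,
Katz–Lindell 2014 §8.2.3) implies the summit. In print this is the conjunction of two standard remarks: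
the assumption fails against quantum polynomial time (Shor 1997 §5; Katz–Lindell §8.2.3), and average-case
hardness is stronger than worst-case hardness of the DECISION problem `FACT`. PROOF PLAN for the discharge
`theorem FactoringAssumptionImpliesQuantumAdvantage_holds`: (i) `FactoringAssumption → FACTNotMemBPP`
(contrapositive): from `FACT ∈ BPP` build a PPT `A` that, on `(1ᵐ, N)`, amplifies the `BPP` decider for
`⟨N, k⟩ ∈ FACT` to error `2^{-2m}` (`BPP` error reduction, in tree) and binary-searches the least divisor
`d > 1` of `N` (`m + 1` adaptive queries; `mem_factSet_iff_minFac_le`), outputting `encodeNat d`; on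
`N = P·Q` with `P, Q` prime, `d = min P Q`, so `A` succeeds with probability `≥ 1 − (m+1)·2^{-2m}`, and
`primePairAvg m (success) ≥ 1/2` for large `m` is not negligible (`SuperpolynomialDecay` fails already
against `k = 0`) — the search-to-decision wrapper is the tree's `RandAlg` composition API
(`OneWayFunctions.lean`, `IsPPT` closure under polynomially many oracle calls, cf. the `WhiteBoxWalk`
Theorems files `isOneWay_genPQ`); (ii) conclude with `factNotMemBPP_implies_quantumAdvantage` (this file).
[cite: Goldreich2001, §2.2.4.1 (the factoring assumption; broken by quantum computers)] -/
@[summit_bridge "QuantumAdvantage.QuantumAdvantage"]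
def FactoringAssumptionImpliesQuantumAdvantage : Prop :=
  FactoringAssumption → _root_.QuantumAdvantage

end Summit.QuantumAdvantage.StrongHypotheses

end
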